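import Mathlib
import Literature.RingTheory.MvPowerSeries.MaximalIdealPow
import Summits.ResolutionOfSingularities.ResolutionOfSingularities.Theorems.WeightedInvariantLocalWeightedDropTOT2PairValFinite

/-!
# TOT2-LINE (P3) brick D8, part 1/3: KILLING `u₂` — the plane contraction of a LINE-TYPE top-locus prime is principal with a generator of
# `y`-order one

Sub-problem `ResolutionOfSingularities`, ENGINE crux `stmt-ResolutionOfSingularities-8899` (`LocalWeightedDrop`), skeleton v35 (2e806da509994632),
registered stub `stub_conflictBudget` (P3); dictionary brick **D8 `X_one_not_mem_of_wellPrepared`** — the hypothesis `hNL` of the graph step of the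
conflict budget (res-L1-w43-stub-2 g6 WANT-HAND 2026-08-27T21:24:55Z, exact target; res-L1-w43-plan-1 RULING 21:25:12Z; this hand res-L1-w43-stub-1 g7).
[OURS · L1 W4.3 · chain w43.  Engine bookkeeping: nothing here is a statement of any manuscript; AI-produced, gate-checked, weaker than expert review.
«[OURS · L1 W4.3] replaces the role of nothing printed; NOT a statement of the manuscript.»]

THE ARGUMENT OF D8 (parts 1–3).  Let `P ∋ u₂`, `P ∌ u₁` be a one-dimensional prime of `R₃ = k⟦u₁,u₂,y⟧` with `s ∉ P`, `s F ∈ P^d` for the monic germ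
`F = y^d + Σ A_j y^j` of a position (`A_j(0) = 0`).  (1) Modulo `u₂` (`ρ = killCompl`, `ι = rename` along `Fin.succAboveEmb 1`), `ι⁻¹P ⊂ k⟦u₁,y⟧` is
a non-zero non-maximal prime of a two-dimensional UFD, hence `(g)` with `g` prime; `g^d ∣ F(u₁,0,y)` and killing `u₁` too (`F(0,0,y) = y^d`)
counts orders: `∂g/∂y(0) ≠ 0` (`exists_generator_comap`).  (2) Formal implicit function: `g(u₁, φ(u₁)) = 0`, and `P = σ_φ⁻¹(u₂, y)` for the
re-centring `σ_φ : y ↦ y + φ` (part 2).  (3) The weight `(0,1,1)` reads `s F ∈ P^d` as `F_φ ∈` weight `≥ d`, i.e. `V(y,u₂)` permissible for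
`shift d A φ`, hence for `A` on a well-prepared position (`isPermissibleTwoT_of_shift`) — so a well-prepared non-`Perm2` position has NO such prime
(part 3, `X_one_not_mem_of_wellPrepared`).
-/

set_option linter.dupNamespace false -- mandated namespace of this single-conjunct summit

noncomputable section

namespace Summit.ResolutionOfSingularities.ResolutionOfSingularities.Theorems

namespace TOT2Branch

open MvPowerSeries IsLocalRing

variable {k : Type} [Field k]


/-! ## §1 Killing a variable: `rename e ∘ killCompl e` fixes the series supported on the range of `e` -/

/-- A series all of whose monomials are supported on the range of an embedding `e` is fixed by `rename e ∘ killCompl e`. -/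
theorem rename_killCompl_of_coeff_eq_zero {σ τ : Type} [Fintype σ] [Fintype τ] (e : σ ↪ τ) (f : MvPowerSeries τ k)
    (hf : ∀ x : τ →₀ ℕ, ¬ (↑x.support ⊆ Set.range e) → coeff x f = 0) :
    rename e (killCompl e f) = f := by
  classical
  ext x
  by_cases hx : (↑x.support ⊆ Set.range e)
  · obtain ⟨y, rfl⟩ := (Finsupp.mem_range_embDomain_iff e x).mpr hx
    rw [coeff_embDomain_rename, coeff_killCompl]
  · rw [hf x hx, coeff_rename_eq_zero]
    intro hmem
    apply hx
    rw [← Finsupp.mem_range_embDomain_iff]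
    obtain ⟨y, hy⟩ := hmem
    exact ⟨y, by rw [Finsupp.embDomain_eq_mapDomain]; exact hy⟩

/-- The embedding `(u₁, y) ↦ (u₁, y)` of the plane `u₂ = 0`: `Fin.succAboveEmb 1 : Fin 2 ↪ Fin 3` (`0 ↦ 0`, `1 ↦ 2`). -/
theorem succAbove_one_zero : (Fin.succAboveEmb (1 : Fin 3)) 0 = (0 : Fin 3) := by decide

/-- Second value of the embedding. -/
theorem succAbove_one_one : (Fin.succAboveEmb (1 : Fin 3)) 1 = (2 : Fin 3) := by decide

/-- `1` is not in the range of `Fin.succAboveEmb 1`. -/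
theorem one_not_mem_range_succAbove_one : (1 : Fin 3) ∉ Set.range (Fin.succAboveEmb (1 : Fin 3)) := by
  rintro ⟨i, hi⟩
  exact Fin.succAbove_ne 1 i hi

/-- A monomial exponent avoids `u₂` iff it is supported on the range of `Fin.succAboveEmb 1`. -/
theorem support_subset_range_iff (x : Fin 3 →₀ ℕ) : (↑x.support ⊆ Set.range (Fin.succAboveEmb (1 : Fin 3))) ↔ x 1 = 0 := by
  constructor
  · intro h
    by_contra h1
    exact one_not_mem_range_succAbove_one (h (by simpa using h1))
  · intro h1 i hi
    rw [Finset.mem_coe, Finsupp.mem_support_iff] at hi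
    fin_cases i
    · exact ⟨0, succAbove_one_zero⟩
    · exact absurd h1 hi
    · exact ⟨1, succAbove_one_one⟩

/-- **Every series is congruent modulo `u₂` to its `u₂`-free part**: `f − ι(ρ f) ∈ (u₂)` for `ρ = killCompl`, `ι = rename` along
`Fin.succAboveEmb 1`. -/
theorem sub_rename_killCompl_mem_span (f : MvPowerSeries (Fin 3) k) :
    f - rename (Fin.succAboveEmb (1 : Fin 3)) (killCompl (Fin.succAboveEmb (1 : Fin 3)) f) ∈ Ideal.span {(X 1 : MvPowerSeries (Fin 3) k)} := by
  classical
  apply Ideal.mem_span_singleton.mpr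
  refine X_dvd_iff.mpr fun x hx => ?_
  obtain ⟨y, rfl⟩ := (Finsupp.mem_range_embDomain_iff _ x).mpr ((support_subset_range_iff x).mpr hx)
  rw [map_sub, coeff_embDomain_rename, coeff_killCompl, sub_self]

/-- For an ideal containing `u₂`: `f ∈ P ⟺ ρ f ∈ ι⁻¹ P`. -/
theorem mem_iff_killCompl_mem_comap {P : Ideal (MvPowerSeries (Fin 3) k)} (hX1 : (X 1 : MvPowerSeries (Fin 3) k) ∈ P) (f : MvPowerSeries (Fin 3) k) :
    f ∈ P ↔ killCompl (Fin.succAboveEmb (1 : Fin 3)) f ∈ P.comap (rename (Fin.succAboveEmb (1 : Fin 3)) : MvPowerSeries (Fin 2) k →ₐ[k] MvPowerSeries (Fin 3) k) := by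
  rw [Ideal.mem_comap]
  have h := sub_rename_killCompl_mem_span f
  have h' : f - rename (Fin.succAboveEmb (1 : Fin 3)) (killCompl (Fin.succAboveEmb (1 : Fin 3)) f) ∈ P :=
    (Ideal.span_singleton_le_iff_mem _ |>.mpr hX1) h
  exact ⟨fun hf => (Submodule.sub_mem_iff_right _ hf).mp h', fun hg => (Submodule.sub_mem_iff_left _ hg).mp h'⟩

/-! ## §2 The plane contraction `P̄ = ι⁻¹P` of a one-dimensional prime `P ∋ u₂`, `P ∌ u₁` is principal -/

/-- `dim k⟦X₀,X₁⟧ = 2`: there is no chain `P₀ < P₁ < P₂ < P₃` of prime ideals. -/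
theorem no_chain_three {P₀ P₁ P₂ P₃ : Ideal (MvPowerSeries (Fin 2) k)} [P₀.IsPrime] [P₁.IsPrime] [P₂.IsPrime] [P₃.IsPrime]
    (h₁ : P₀ < P₁) (h₂ : P₁ < P₂) (h₃ : P₂ < P₃) : False := by
  have hdim : ringKrullDim (MvPowerSeries (Fin 2) k) = ((2 : ℕ∞) : WithBot ℕ∞) := by
    rw [Literature.AlgebraicGeometry.Resolution.ringKrullDim_mvPowerSeries k (Fin 2), Nat.card_eq_fintype_card, Fintype.card_fin]
    norm_cast
  have e1 := Ideal.height_add_one_le_of_lt_of_isPrime h₁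
  have e2 := Ideal.height_add_one_le_of_lt_of_isPrime h₂
  have e3 := Ideal.height_add_one_le_of_lt_of_isPrime h₃
  have e5 : (P₃.height : WithBot ℕ∞) ≤ ((2 : ℕ∞) : WithBot ℕ∞) := by
    have h := Ideal.height_le_ringKrullDim_of_isPrime (I := P₃)
    rwa [hdim] at h
  have e5' : P₃.height ≤ 2 := WithBot.coe_le_coe.mp e5
  have a1 : (1 : ℕ∞) ≤ P₁.height := le_trans le_add_self e1
  have a2 : (1 + 1 : ℕ∞) ≤ P₂.height := le_trans (by gcongr) e2
  have a3 : (1 + 1 + 1 : ℕ∞) ≤ P₃.height := le_trans (by gcongr) e3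
  have h5 : (1 + 1 + 1 : ℕ∞) ≤ 2 := a3.trans e5'
  have h6 : (1 + 1 + 1 : ℕ) ≤ 2 := by exact_mod_cast h5
  omega

/-- **A non-zero, non-maximal prime of `k⟦X₀,X₁⟧` is principal**, generated by a prime element (UFD of dimension two). -/
theorem exists_eq_span_singleton_of_prime {Q : Ideal (MvPowerSeries (Fin 2) k)} [hQ : Q.IsPrime] (h0 : Q ≠ ⊥)
    (hm : Q ≠ maximalIdeal (MvPowerSeries (Fin 2) k)) : ∃ g : MvPowerSeries (Fin 2) k, Prime g ∧ Q = Ideal.span {g} := by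
  classical
  haveI := TameFourTupleDrop.uniqueFactorizationMonoid_mvPowerSeries (k := k) 2
  obtain ⟨g, hgQ, hg⟩ := hQ.exists_mem_prime_of_ne_bot h0
  refine ⟨g, hg, ?_⟩
  haveI hsp : (Ideal.span {g}).IsPrime := (Ideal.span_singleton_prime hg.ne_zero).mpr hg
  by_contra hne
  have h1 : (⊥ : Ideal (MvPowerSeries (Fin 2) k)) < Ideal.span {g} := by
    rw [bot_lt_iff_ne_bot, Ne, Ideal.span_singleton_eq_bot]; exact hg.ne_zero
  have h2 : Ideal.span {g} < Q := lt_of_le_of_ne ((Ideal.span_singleton_le_iff_mem _).mpr hgQ) (Ne.symm hne)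
  have h3 : Q < maximalIdeal (MvPowerSeries (Fin 2) k) := lt_of_le_of_ne (IsLocalRing.le_maximalIdeal hQ.ne_top) hm
  haveI : (⊥ : Ideal (MvPowerSeries (Fin 2) k)).IsPrime := Ideal.isPrime_bot
  exact no_chain_three h1 h2 h3

/-! ### Killing `u₁` and `u₂`: `F(0,0,y) = y^d` -/

/-- The embedding of the `y`-axis: `Fin 1 ↪ Fin 3`, `0 ↦ 2`, as the composite `(0 ↦ 1) ∘ (1 ↦ 2)`… precisely
`(Fin.succAboveEmb 0 : Fin 1 ↪ Fin 2).trans (Fin.succAboveEmb 1)`; its value. -/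
theorem trans_apply_zero : ((Fin.succAboveEmb (0 : Fin 2)).trans (Fin.succAboveEmb (1 : Fin 3))) 0 = (2 : Fin 3) := by decide

/-- Killing `u₁` after `u₂` is killing both. -/
theorem killCompl_trans_apply (f : MvPowerSeries (Fin 3) k) :
    killCompl ((Fin.succAboveEmb (0 : Fin 2)).trans (Fin.succAboveEmb (1 : Fin 3))) f =
      killCompl (Fin.succAboveEmb (0 : Fin 2)) (killCompl (Fin.succAboveEmb (1 : Fin 3)) f) := by
  classical
  ext x
  rw [Finsupp.unique_single x, coeff_killCompl, coeff_killCompl, coeff_killCompl, Finsupp.embDomain_single, Finsupp.embDomain_single,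
    Finsupp.embDomain_single]
  rfl

/-- Killing `u₁, u₂` on a plane series leaves its constant term. -/
theorem killCompl_trans_toThree (q : MvPowerSeries (Fin 2) k) :
    killCompl ((Fin.succAboveEmb (0 : Fin 2)).trans (Fin.succAboveEmb (1 : Fin 3))) (toThree q) = C (constantCoeff q) := by
  classical
  ext x
  rw [Finsupp.unique_single x, Fin.default_eq_zero, coeff_killCompl, Finsupp.embDomain_single, coeff_C, trans_apply_zero]
  by_cases hn : x 0 = 0
  · rw [hn, Finsupp.single_zero, Finsupp.single_zero, if_pos rfl, MvPowerSeries.coeff_zero_eq_constantCoeff_apply]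
    change constantCoeff (rename _ q) = _
    rw [constantCoeff_rename]
  · rw [if_neg (by rwa [Finsupp.single_eq_zero]), coeff_toThree_eq_zero q (by change (Finsupp.single (2 : Fin 3) _) 2 ≠ 0; rwa [Finsupp.single_eq_same])]

/-- **`F(0,0,y) = y^d`** for a label whose coefficients have no constant term. -/
theorem killCompl_trans_monicGerm {d : ℕ} {A : Fin d → MvPowerSeries (Fin 2) k} (hA : ∀ j, constantCoeff (A j) = 0) :
    killCompl ((Fin.succAboveEmb (0 : Fin 2)).trans (Fin.succAboveEmb (1 : Fin 3))) (NCPoly.monicGerm d A) = (X 0 : MvPowerSeries (Fin 1) k) ^ d := by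
  have hX : killCompl ((Fin.succAboveEmb (0 : Fin 2)).trans (Fin.succAboveEmb (1 : Fin 3))) (X (Fin.last 2) : MvPowerSeries (Fin 3) k) =
      (X 0 : MvPowerSeries (Fin 1) k) := by
    rw [show (Fin.last 2 : Fin 3) = ((Fin.succAboveEmb (0 : Fin 2)).trans (Fin.succAboveEmb (1 : Fin 3))) 0 from trans_apply_zero.symm, killCompl_X]
  rw [NCPoly.monicGerm, map_add, map_pow, hX, map_sum, Finset.sum_eq_zero (fun j _ => ?_), add_zero]
  rw [map_mul, map_pow, hX]
  change killCompl _ (toThree (A j)) * _ = 0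
  rw [killCompl_trans_toThree, hA, map_zero, zero_mul]

/-- The variable of `k⟦T⟧ = MvPowerSeries (Fin 1) k` is non-zero. -/
theorem X_zero_ne_zero_one : (X 0 : MvPowerSeries (Fin 1) k) ≠ 0 := fun h => by
  have := congrArg (coeff (Finsupp.single 0 1)) h
  rw [coeff_X, if_pos rfl, map_zero] at this
  exact one_ne_zero this

/-- **THE PLANE CONTRACTION OF A LINE-TYPE TOP-LOCUS PRIME IS PRINCIPAL, WITH A GENERATOR OF `y`-ORDER ONE.**  Let `P` be a one-dimensional prime
of `R₃` with `u₂ ∈ P`, `u₁ ∉ P`, `s ∉ P`, `s·F ∈ P^d` for the monic germ `F` of a label `A` with `A_j(0) = 0` (`d ≥ 1`).  Then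
`P̄ = ι⁻¹P ⊂ k⟦u₁, y⟧` is generated by a prime `g` with `g(0) = 0` and `∂g/∂y (0) ≠ 0`. -/
theorem exists_generator_comap {d : ℕ} (hd : 0 < d) {A : Fin d → MvPowerSeries (Fin 2) k} (hA : ∀ j, constantCoeff (A j) = 0)
    {P : Ideal (MvPowerSeries (Fin 3) k)} [hP : P.IsPrime]
    (hX1 : (X 1 : MvPowerSeries (Fin 3) k) ∈ P) (hX0 : (X 0 : MvPowerSeries (Fin 3) k) ∉ P)
    {s : MvPowerSeries (Fin 3) k} (hs : s ∉ P) (hsF : s * NCPoly.monicGerm d A ∈ P ^ d) :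
    ∃ g : MvPowerSeries (Fin 2) k, Prime g ∧
      P.comap (rename (Fin.succAboveEmb (1 : Fin 3)) : MvPowerSeries (Fin 2) k →ₐ[k] MvPowerSeries (Fin 3) k) = Ideal.span {g} ∧
      constantCoeff g = 0 ∧ coeff (Finsupp.single 1 1) g ≠ 0 := by
  classical
  set ρ : MvPowerSeries (Fin 3) k →ₐ[k] MvPowerSeries (Fin 2) k := killCompl (Fin.succAboveEmb (1 : Fin 3)) with hρ
  set Q : Ideal (MvPowerSeries (Fin 2) k) :=
    P.comap (rename (Fin.succAboveEmb (1 : Fin 3)) : MvPowerSeries (Fin 2) k →ₐ[k] MvPowerSeries (Fin 3) k) with hQ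
  haveI hQp : Q.IsPrime := Ideal.comap_isPrime _ _
  have hmem : ∀ f, f ∈ P ↔ ρ f ∈ Q := fun f => mem_iff_killCompl_mem_comap hX1 f
  have hF : NCPoly.monicGerm d A ∈ P := NCBranchPrimes.mem_of_mul_mem_pow hP hd.ne' hs hsF
  have hρX0 : ρ (X 0) = X 0 := by rw [hρ, ← succAbove_one_zero, killCompl_X]
  -- the double kill
  set κ : MvPowerSeries (Fin 3) k →ₐ[k] MvPowerSeries (Fin 1) k :=
    killCompl ((Fin.succAboveEmb (0 : Fin 2)).trans (Fin.succAboveEmb (1 : Fin 3))) with hκ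
  set κ₀ : MvPowerSeries (Fin 2) k →ₐ[k] MvPowerSeries (Fin 1) k := killCompl (Fin.succAboveEmb (0 : Fin 2)) with hκ₀
  have hκρ : ∀ f, κ f = κ₀ (ρ f) := fun f => killCompl_trans_apply f
  have hκF : κ (NCPoly.monicGerm d A) = X 0 ^ d := killCompl_trans_monicGerm hA
  -- `Q ≠ ⊥`, `Q ≠ 𝔪`
  have hQ0 : Q ≠ ⊥ := by
    intro h
    have h1 : ρ (NCPoly.monicGerm d A) = 0 := by
      have := (hmem _).mp hF; rw [h, Ideal.mem_bot] at this; exact this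
    have h2 : κ (NCPoly.monicGerm d A) = 0 := by rw [hκρ, h1, map_zero]
    rw [hκF] at h2
    exact pow_ne_zero d X_zero_ne_zero_one h2
  have hQm : Q ≠ maximalIdeal (MvPowerSeries (Fin 2) k) := by
    intro h
    have h1 : ρ (X 0) ∈ Q := by
      rw [h, hρX0]; exact Literature.AlgebraicGeometry.Resolution.X_mem_maximalIdeal k (Fin 2) 0
    exact hX0 ((hmem _).mpr h1)
  obtain ⟨g, hg, hQg⟩ := exists_eq_span_singleton_of_prime hQ0 hQm
  refine ⟨g, hg, hQg, ?_, ?_⟩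
  · -- `g ∈ Q ⊆ 𝔪`
    have hgQ : g ∈ Q := by rw [hQg]; exact Ideal.mem_span_singleton_self g
    have hgm : g ∈ maximalIdeal (MvPowerSeries (Fin 2) k) := IsLocalRing.le_maximalIdeal hQp.ne_top hgQ
    exact Literature.RingTheory.MvPowerSeries.Jets.mem_maximalIdeal_iff_constantCoeff_eq_zero.mp hgm
  · -- `g^d ∣ ρ F`, then count orders after killing `u₁`
    have hdvd : g ^ d ∣ ρ (NCPoly.monicGerm d A) := by
      have h1 : ρ s * ρ (NCPoly.monicGerm d A) ∈ Q ^ d := by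
        rw [← map_mul]
        have h2 : P ^ d ≤ (Q ^ d).comap ρ := by
          rw [← Ideal.map_le_iff_le_comap, Ideal.map_pow]
          refine Ideal.pow_right_mono ?_ d
          rw [Ideal.map_le_iff_le_comap]
          intro f hf
          exact (hmem f).mp hf
        exact h2 hsF
      rw [hQg, Ideal.span_singleton_pow, Ideal.mem_span_singleton] at h1
      exact hg.pow_dvd_of_dvd_mul_left d (fun h => hs ((hmem s).mpr (by rw [hQg]; exact Ideal.mem_span_singleton.mpr h))) h1
    obtain ⟨h, hh⟩ := hdvd
    -- orders after killing `u₁`: `ord(κ₀ g) · d + ord(κ₀ h) = d`, `ord(κ₀ g) ≥ 1`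
    have h1 : (κ₀ g) ^ d * κ₀ h = X 0 ^ d := by rw [← map_pow, ← map_mul, ← hh, ← hκρ, hκF]
    have hXd : ((X 0 : MvPowerSeries (Fin 1) k) ^ d).order = d := by
      rw [X_pow_eq, order_monomial_of_ne_zero one_ne_zero, Finsupp.degree_single]
    have hg1 : 1 ≤ (κ₀ g).order := by
      rw [one_le_order_iff_constCoeff_eq_zero]
      change constantCoeff (killCompl _ g) = 0
      rw [← coeff_zero_eq_constantCoeff_apply, coeff_killCompl, Finsupp.embDomain_zero, coeff_zero_eq_constantCoeff_apply]
      have hgQ : g ∈ Q := by rw [hQg]; exact Ideal.mem_span_singleton_self g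
      exact Literature.RingTheory.MvPowerSeries.Jets.mem_maximalIdeal_iff_constantCoeff_eq_zero.mp (IsLocalRing.le_maximalIdeal hQp.ne_top hgQ)
    have hpow : ∀ n : ℕ, ((κ₀ g) ^ n).order = n * (κ₀ g).order := by
      intro n
      induction n with
      | zero =>
        rw [pow_zero, Nat.cast_zero, zero_mul]
        have h1 : ¬ (1 ≤ (1 : MvPowerSeries (Fin 1) k).order) := by
          rw [one_le_order_iff_constCoeff_eq_zero, map_one]; exact one_ne_zero
        rw [not_le, Order.lt_one_iff] at h1
        exact h1
      | succ n ih => rw [pow_succ, order_mul, ih, Nat.cast_succ, add_mul, one_mul]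
    have hsum : (d : ℕ∞) * (κ₀ g).order + (κ₀ h).order = d := by
      have := congrArg MvPowerSeries.order h1
      rwa [order_mul, hpow, hXd] at this
    have hgo : (κ₀ g).order = 1 := by
      have hd0 : (d : ℕ∞) ≠ 0 := by exact_mod_cast hd.ne'
      have hgt : (κ₀ g).order ≠ ⊤ := by
        intro ht
        rw [ht, ENat.mul_top hd0, top_add] at hsum
        exact ENat.coe_ne_top d hsum.symm
      have hht : (κ₀ h).order ≠ ⊤ := by
        intro ht
        rw [ht, add_top] at hsum
        exact ENat.coe_ne_top d hsum.symm
      obtain ⟨n, hn⟩ : ∃ n : ℕ, (κ₀ g).order = n := ⟨_, (ENat.coe_toNat hgt).symm⟩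
      obtain ⟨m, hm⟩ : ∃ m : ℕ, (κ₀ h).order = m := ⟨_, (ENat.coe_toNat hht).symm⟩
      rw [hn, hm] at hsum
      rw [hn] at hg1 ⊢
      have h2 : d * n + m = d := by exact_mod_cast hsum
      have h3 : 1 ≤ n := by exact_mod_cast hg1
      have h4 : n ≤ 1 := by nlinarith
      have h5 : n = 1 := le_antisymm h4 h3
      rw [h5]; rfl
    -- the `y`-linear coefficient of `g`
    obtain ⟨x, hx, hxdeg⟩ := exists_coeff_ne_zero_and_order (f := κ₀ g) (by rw [hgo]; rfl)
    rw [hgo] at hxdeg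
    have hx1 : x = Finsupp.single 0 1 := by
      rw [Finsupp.unique_single x]
      congr 1
      have : (x.degree : ℕ∞) = 1 := hxdeg
      rw [Finsupp.unique_single x, Finsupp.degree_single] at this
      exact_mod_cast this
    rw [hx1, hκ₀, coeff_killCompl, Finsupp.embDomain_single] at hx
    exact hx

end TOT2Branch

end Summit.ResolutionOfSingularities.ResolutionOfSingularities.Theorems

end
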